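import Summits.RiemannHypothesis.RiemannHypothesis.Theorems.FormatCPsdBands
import HarnessLib

/-!
# Format C kernel certificates: the shape/symmetry premise of `checkPsdMid_of_bands` by ROW BANDS

Helper file (`--supports stmt-RiemannHypothesis-18085`), RH-free, no data, no definitions.  Prover A (gen 23 of unit `sr-gb-rung-a`).

`PsdDyadic.checkPsdShape n mid L` (lengths + symmetry of the `n × n` claimed table `mid`) is the premise of
`FormatCPsd.checkPsdMid_of_bands`; the column-band rungs prove it by ONE kernel fact `checkPsdShapeFast n mid L = true`
(`transposeZ mid == mid`), which at `n = 192` with `2²⁵⁰`-unit entries costs ≈ 550 s of kernel time — at the gate's 600-s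
elaboration cap (lane ODD97 `…O97CBOddPsd5`: 550 s; lane ODD100 `…O100CBOddPsd7`: timed out).  This file splits the premise into
cheap kernel facts: per row band `i₀ ≤ i < i₀ + k` the Boolean
`(List.range' i₀ k).all (fun i ↦ (List.range i).all fun j ↦ decide (getMZ mid i j = getMZ mid j i))` (symmetry against the lower
triangle), plus the four length conditions; `checkPsdShape_of_symmBands` assembles them.
-/

set_option linter.dupNamespace false

namespace Summit.RiemannHypothesis.RiemannHypothesis.Theorems.FormatCPsd

open Literature.NumberTheory.LFunctions.PsdDyadic

/-- `allBelowN` from a pointwise hypothesis. [folklore] -/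
private theorem allBelowN_of_forall' {n : ℕ} {P : ℕ → Bool} (h : ∀ k < n, P k = true) : allBelowN n P = true := by
  induction n with
  | zero => rfl
  | succ n ih =>
    show (allBelowN n P && P n) = true
    rw [Bool.and_eq_true]
    exact ⟨ih fun k hk ↦ h k (by omega), h n (by omega)⟩

/-- A certified symmetry band gives the pointwise symmetry of its rows against the lower triangle. [folklore] -/
theorem symm_of_symmBand {mid : List (List ℤ)} {i₀ k : ℕ}
    (h : (List.range' i₀ k).all (fun i ↦ (List.range i).all fun j ↦ decide (getMZ mid i j = getMZ mid j i)) = true)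
    {i j : ℕ} (hi : i₀ ≤ i) (hik : i < i₀ + k) (hj : j < i) : getMZ mid i j = getMZ mid j i := by
  rw [List.all_eq_true] at h
  have hrow := h i (by rw [List.mem_range']; exact ⟨i - i₀, by omega, by omega⟩)
  rw [List.all_eq_true] at hrow
  exact of_decide_eq_true (hrow j (List.mem_range.2 hj))

/-- **`checkPsdShape` from the four length conditions and a cover of `[0, n)` by certified symmetry bands.** [folklore] -/
theorem checkPsdShape_of_symmBands {n : ℕ} {mid L : List (List ℤ)}
    (hlen : (decide (mid.length = n) && decide (L.length = n) && mid.all (fun r ↦ decide (r.length = n))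
      && L.all (fun r ↦ decide (r.length ≤ n))) = true)
    (hcov : ∀ i < n, ∃ i₀ k,
      (List.range' i₀ k).all (fun i ↦ (List.range i).all fun j ↦ decide (getMZ mid i j = getMZ mid j i)) = true ∧
        i₀ ≤ i ∧ i < i₀ + k) :
    checkPsdShape n mid L = true := by
  unfold checkPsdShape
  simp only [Bool.and_eq_true] at hlen ⊢
  refine ⟨hlen, ?_⟩
  unfold symmCheck
  refine allBelowN_of_forall' fun i hi ↦ allBelowN_of_forall' fun j hj ↦ ?_
  obtain ⟨i₀, k, hb, h1, h2⟩ := hcov i hi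
  rw [decide_eq_true_eq]
  exact symm_of_symmBand hb h1 h2 hj

end Summit.RiemannHypothesis.RiemannHypothesis.Theorems.FormatCPsd
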